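import Summits.QuantumFields.BalabanUV.T4Continuum.Support.NE7SliceStraightening
import Summits.QuantumFields.BalabanUV.T4Continuum.Support.NE7SliceQuadraticGrowthStabConst
import Summits.QuantumFields.BalabanUV.T4Continuum.Support.NE7ImplicitCriticalPoint
import Summits.QuantumFields.BalabanUV.T4Continuum.Support.NE7QuadraticGrowthSecondDerivative
import HarnessLib

/-!
# NE7SliceCriticalBranchStabConst — THE `C¹` CRITICAL BRANCH IN SLICE-FIBRE COORDINATES UNDER THE WEAK STABILISER HYPOTHESIS (G3) (ROAD-G114 §10): verbatim ✓ p825051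
# `NE7SliceCriticalBranch.slice_critical_branch` with the genericity hypothesis replaced by (G3) «every unitary `N`-periodic stabiliser of `V₀` is a constant gauge whose constant fine
# extension fixes `U♯`» (covers the FLAT datum `V₀ = 1`, `U♯ = 1`), through ✓ `NE7SliceQuadraticGrowthStabConst.slice_quadratic_growth_of_stab_const`

Cell `pub-balaban`, rung (B)+1 sub-cell t4, lineage `b2b-balaban-t4-ne7-p1` (CRUX PROVER NE7 #1 = OWNER of BINDER row NE7), generation 114.  Memo `t4/b2b-balaban-t4-ne7-p1-g114/ROAD-G114.md` §10.
WHAT ([folklore]; 0 def, 0 sorry; `d = 4`, every `U(n)`, `L ≥ 2`).  **`slice_critical_branch_of_stab_const`**.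
HONEST FRAMING (page 1): composition of landed letters; constants∕radii existential; (G3) is a HYPOTHESIS; nothing of Bałaban's; NOT NE7, NOT NE3; spine 0∕9; finite T⁴ rung (B)+1 — NOT
infinite volume, NOT mass gap, NOT BetaPertH, NOT Clay.
-/

set_option autoImplicit false

open scoped BigOperators Matrix Matrix.Norms.L2Operator Topology
open NormedSpace Finset Set Filter Metric

namespace Summit.QuantumFields.BalabanUV.T4Continuum.NE7SliceCriticalBranchStabConst

open Literature.MathematicalPhysics.QuantumFieldTheory.Balaban1983to89 open B7Prop1Explicit B7Prop2Explicit
open T4AveragingDeficitWall (IsUnitaryCfg SmallField fineAction) open T4AveragingDeficitWallBoundary (IsPeriodicCfg)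
open AveragingDeficitTorusChart (TDir chart chart_zero redN)
open AveragingDeficitChartCalculus (relLog relLog_self contDiffAt_fineAction_chart) open AveragingDeficitTwoLevelPrep (skewSub skewPR)
open AveragingDeficitMultiLevelPrep (tower levelQ LevelSmall tower_ne_zero)
open MinimalActionLevels (perWin levelAction stepWt stepWt_pos)
open MinimalActionSandwich (IsMinimiser admissible) open MinimalActionRate (sfClass)
open NE3EnergyShapes (IsUnitarySite IsPeriodicSite)
open NE7MinimalOrbitDatumContinuity (thresholds)
open NE7SliceStraightening (slice_straightening) open NE7SliceQuadraticGrowthStabConst (slice_quadratic_growth_of_stab_const)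
open NE7ImplicitCriticalPoint (implicit_critical_point) open NE7QuadraticGrowthSecondDerivative (second_derivative_ge_of_quadratic_growth)

noncomputable section

variable {n : Type} [Fintype n] [DecidableEq n]

set_option maxHeartbeats 2400000 in
/-- **THE `C¹` CRITICAL BRANCH IN SLICE-FIBRE COORDINATES** (see the module docstring): the slice package `(Sl, ξ, σ, θ_Σ, Q̄′|_Σ, π_Σ)` at a minimiser `U♯` over a generic datum
`V₀`, and `z⋆ : skewSub N → ker Q̄′|_Σ`, `C¹` at `0`, `z⋆(0) = 0`, with `∂_z g(y, z⋆(y)) = 0` near `0` and `∂_z g(y, z) = 0 ↔ z = z⋆(y)` near `0`, where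
`g(y, z) = A(chart_{U♯} θ_Σ(y, z))` is `C²` at `0`. [folklore] -/
theorem slice_critical_branch_of_stab_const [Nonempty n] {L : ℕ} [NeZero L] (hL : 2 ≤ L) :
    ∃ ε₀ : ℝ, 0 < ε₀ ∧ ∀ ε : ℝ, 0 < ε → ε ≤ ε₀ → ∀ (N : ℕ) [NeZero N], 1 ≤ N →
      ∀ (V₀ : Site 4 → Fin 4 → (Matrix n n ℂ)ˣ) (j : ℕ) (Us : Site 4 → Fin 4 → (Matrix n n ℂ)ˣ), IsUnitaryCfg V₀ → IsPeriodicCfg V₀ (N : ℤ) →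
        IsMinimiser 4 (sfClass 4 L N ε) L N (j + 1) V₀ Us →
        ∀ a : ℝ, 0 ≤ a → a < ε / ((L : ℝ) ^ (j + 1)) ^ 2 → SmallField Us a →
        (∀ s : Site 4 → (Matrix n n ℂ)ˣ, IsUnitarySite s → IsPeriodicSite s (N : ℤ) → gaugeAct s V₀ = V₀ →
            (∀ z : Site 4, s z = s 0) ∧ gaugeAct (fun _ : Site 4 => s 0) Us = Us) →
        ∃ (Sl : Submodule ℝ (TDir 4 n (L * tower L N j)))
          (ξ : ↥(skewSub 4 n (L * tower L N j)) → ((Fin 4 → Fin (L * tower L N j)) → Matrix n n ℂ))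
          (σ : ↥(skewSub 4 n (L * tower L N j)) → ↥(skewSub 4 n (L * tower L N j)))
          (θS : ↥(skewSub 4 n N) × ↥Sl → ↥Sl) (KT : Submodule ℝ (TDir 4 n (L * tower L N j))) (iK : ↥KT →L[ℝ] ↥Sl) (πT : ↥Sl → ↥KT)
          (zs : ↥(skewSub 4 n N) → ↥KT),
          Sl ≤ skewSub 4 n (L * tower L N j) ∧ ContDiffAt ℝ 2 ξ 0 ∧ ContDiffAt ℝ 2 σ 0 ∧ ξ 0 = 0 ∧ σ 0 = 0 ∧
          (∀ Φ, (∀ r, ξ Φ r ∈ skewAdjoint (Matrix n n ℂ)) ∧ (∀ w : Site 4, ξ Φ (redN (L * tower L N j) (((L : ℤ) ^ (j + 1)) • w)) = 0) ∧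
            ((σ Φ : ↥(skewSub 4 n (L * tower L N j))) : TDir 4 n (L * tower L N j)) ∈ Sl) ∧
          (∀ᶠ Φ : ↥(skewSub 4 n (L * tower L N j)) in 𝓝 0,
            skewPR (L * tower L N j) (relLog (L * tower L N j) Us (gaugeAct (fun x : Site 4 => expUnit (ξ Φ (redN (L * tower L N j) x)))
              (chart (ContinuousLinearMap.id ℝ (Matrix n n ℂ)) (L * tower L N j) Us (σ Φ : TDir 4 n (L * tower L N j))))) = Φ) ∧
          ContDiffAt ℝ 2 θS 0 ∧ θS 0 = 0 ∧
          (∀ᶠ p : ↥(skewSub 4 n N) × ↥Sl in 𝓝 0,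
            levelQ L N j Us (chart (ContinuousLinearMap.id ℝ (Matrix n n ℂ)) (L * tower L N j) Us ((θS p : ↥Sl) : TDir 4 n (L * tower L N j))) = p.1 ∧
            chart (ContinuousLinearMap.id ℝ (Matrix n n ℂ)) (L * tower L N j) Us ((θS p : ↥Sl) : TDir 4 n (L * tower L N j)) ∈ sfClass 4 L N ε (j + 1) ∧
            ∀ D : Site 4 → Fin 4 → (Matrix n n ℂ)ˣ, IsUnitaryCfg D → IsPeriodicCfg D (N : ℤ) →
              (∀ (r : Fin 4 → Fin N) (κ' : Fin 4),
                ‖(((V₀ (boxVec N r) κ')⁻¹ : (Matrix n n ℂ)ˣ) : Matrix n n ℂ) * (D (boxVec N r) κ' : Matrix n n ℂ) - 1‖ ≤ 1 / 4) →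
              skewPR N (relLog N V₀ D) = p.1 →
              chart (ContinuousLinearMap.id ℝ (Matrix n n ℂ)) (L * tower L N j) Us ((θS p : ↥Sl) : TDir 4 n (L * tower L N j))
                ∈ admissible (sfClass 4 L N ε) L (j + 1) D) ∧
          -- slice-fibre coordinates, flattened: `iK : KT → Sl` the inclusion, `πT` the fibre coordinate
          (∀ z : ↥KT, ((iK z : ↥Sl) : TDir 4 n (L * tower L N j)) = (z : TDir 4 n (L * tower L N j))) ∧ πT 0 = 0 ∧
          (∀ᶠ s : ↥Sl in 𝓝 0,
            θS (levelQ L N j Us (chart (ContinuousLinearMap.id ℝ (Matrix n n ℂ)) (L * tower L N j) Us (s : TDir 4 n (L * tower L N j))), iK (πT s)) = s) ∧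
          (∃ Kp : ℝ, ∀ᶠ s : ↥Sl in 𝓝 0, ‖πT s‖ ≤ Kp * ‖s‖) ∧
          -- the reduced action and the critical branch
          ContDiffAt ℝ 2 (fun p : ↥(skewSub 4 n N) × ↥KT =>
            fineAction (chart (ContinuousLinearMap.id ℝ (Matrix n n ℂ)) (L * tower L N j) Us ((θS (p.1, iK p.2) : ↥Sl) : TDir 4 n (L * tower L N j)))
              (perWin 4 (N * L ^ (j + 1)))) 0 ∧
          ContDiffAt ℝ 1 zs 0 ∧ zs 0 = 0 ∧
          (∀ᶠ y : ↥(skewSub 4 n N) in 𝓝 0, fderiv ℝ (fun z : ↥KT =>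
            fineAction (chart (ContinuousLinearMap.id ℝ (Matrix n n ℂ)) (L * tower L N j) Us ((θS (y, iK z) : ↥Sl) : TDir 4 n (L * tower L N j)))
              (perWin 4 (N * L ^ (j + 1)))) (zs y) = 0) ∧
          (∀ᶠ p : ↥(skewSub 4 n N) × ↥KT in 𝓝 0,
            fderiv ℝ (fun z : ↥KT =>
              fineAction (chart (ContinuousLinearMap.id ℝ (Matrix n n ℂ)) (L * tower L N j) Us ((θS (p.1, iK z) : ↥Sl) : TDir 4 n (L * tower L N j)))
                (perWin 4 (N * L ^ (j + 1)))) p.2 = 0 ↔ zs p.1 = p.2) := by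
  have hL1 : 1 ≤ L := by omega
  obtain ⟨ε₁, hε₁, H⟩ := thresholds (n := n) hL
  obtain ⟨ε₄, hε₄, H4⟩ := slice_quadratic_growth_of_stab_const (n := n) hL
  refine ⟨min ε₁ ε₄, lt_min hε₁ hε₄, fun ε hε hεle N _ hN V₀ j Us hV₀u hV₀P hUs a ha0 haε hUsa hgen => ?_⟩
  obtain ⟨-, -, hls, -⟩ := H ε hε (hεle.trans (min_le_left _ _))
  haveI : NeZero (L * tower L N j) := ⟨Nat.mul_ne_zero (NeZero.ne L) (tower_ne_zero L N j)⟩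
  -- (S3) the slice package, (S4) quadratic growth on the slice
  obtain ⟨Sl, ξ, σ, θS, G', π, hSlle, hξc, hσc, hξ0, hσ0, hprop, hright, hleft, hθSc, hθS0, -, -, hfibS, -, hπc, hπ0, hπsec, hπfib⟩ :=
    slice_straightening (n := n) hL1 hε.le j (hls j) hUs.mem haε hUsa
  obtain ⟨c, ρ, hc, hρ, hqg⟩ := H4 ε hε (hεle.trans (min_le_right _ _)) N hN V₀ j Us hV₀u hV₀P hUs a ha0 haε hUsa hgen σ Sl hσc hσ0
    (hleft.mono fun p hp h1 h2 h3 => (hp h1 h2 h3).2)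
  haveI : CompleteSpace ↥Sl := FiniteDimensional.complete ℝ _
  -- the fibre `K = ker Q̄′|_Σ`, flattened to a subspace `KT ≤ Sl` of the chart model space
  set KT : Submodule ℝ (TDir 4 n (L * tower L N j)) := (LinearMap.ker (G' : ↥Sl →ₗ[ℝ] ↥(skewSub 4 n N))).map Sl.subtype with hKT
  have hKTle : KT ≤ Sl := Submodule.map_subtype_le _ _
  have hmemKT : ∀ s : ↥Sl, (s : TDir 4 n (L * tower L N j)) ∈ KT ↔ s ∈ LinearMap.ker (G' : ↥Sl →ₗ[ℝ] ↥(skewSub 4 n N)) := fun s => by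
    constructor
    · rintro ⟨y, hy, hys⟩
      have hys' : y = s := Subtype.ext (by simpa using hys)
      rw [← hys']; exact hy
    · intro hs; exact ⟨s, hs, rfl⟩
  haveI : CompleteSpace ↥KT := FiniteDimensional.complete ℝ _
  set iK : ↥KT →L[ℝ] ↥Sl := LinearMap.toContinuousLinearMap (Submodule.inclusion hKTle) with hiKdef
  have hiK : ∀ z : ↥KT, ((iK z : ↥Sl) : TDir 4 n (L * tower L N j)) = (z : TDir 4 n (L * tower L N j)) := fun z => rfl
  have hiKn : ∀ z : ↥KT, ‖iK z‖ = ‖z‖ := fun z => by rw [Submodule.coe_norm, Submodule.coe_norm (x := z), hiK z]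
  set kz : ↥KT → ↥(LinearMap.ker (G' : ↥Sl →ₗ[ℝ] ↥(skewSub 4 n N))) := fun z => ⟨iK z, (hmemKT (iK z)).mp z.2⟩ with hkz
  have hkzc : Continuous kz := iK.continuous.subtype_mk _
  have hkz0 : kz 0 = 0 := Subtype.ext (map_zero iK)
  -- the fibre coordinate read in `Sl` (`πS`) and in `KT` (`πT`)
  set πS : ↥Sl → ↥Sl := fun s => ((π s : ↥(LinearMap.ker (G' : ↥Sl →ₗ[ℝ] ↥(skewSub 4 n N)))) : ↥Sl) with hπS
  have hπSc : ContDiffAt ℝ 2 πS 0 := by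
    have h := ContDiffAt.comp (0 : ↥Sl) (LinearMap.ker (G' : ↥Sl →ₗ[ℝ] ↥(skewSub 4 n N))).subtypeL.contDiff.contDiffAt hπc
    exact h
  have hπS0 : πS 0 = 0 := by simp only [hπS, hπ0, Submodule.coe_zero]
  set πT : ↥Sl → ↥KT := fun s => ⟨((π s : ↥Sl) : TDir 4 n (L * tower L N j)), (hmemKT (π s : ↥Sl)).mpr (π s).2⟩ with hπT
  have hπTi : ∀ s : ↥Sl, iK (πT s) = πS s := fun s => Subtype.ext rfl
  have hπTn : ∀ s : ↥Sl, ‖πT s‖ = ‖πS s‖ := fun s => by rw [← hiKn, hπTi]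
  have hπT0 : πT 0 = 0 := Subtype.ext (by simp only [hπT, hπ0, Submodule.coe_zero])
  obtain ⟨Kπ, tπ, htπ, hπL⟩ := (hπSc.of_le (by norm_num : (1 : WithTop ℕ∞) ≤ 2)).exists_lipschitzOnWith
  have h0tπ : (0 : ↥Sl) ∈ tπ := mem_of_mem_nhds htπ
  have hπTsec : ∀ᶠ s : ↥Sl in 𝓝 0,
      θS (levelQ L N j Us (chart (ContinuousLinearMap.id ℝ (Matrix n n ℂ)) (L * tower L N j) Us (s : TDir 4 n (L * tower L N j))), iK (πT s)) = s :=
    hπsec.mono fun s hs => by rw [hπTi]; exact hs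
  have hπTK : ∀ᶠ s : ↥Sl in 𝓝 0, ‖πT s‖ ≤ Kπ * ‖s‖ := by
    filter_upwards [Filter.eventually_of_mem htπ fun x hx => hx] with s hs
    have h := hπL.norm_sub_le hs h0tπ
    rw [hπS0, sub_zero, sub_zero] at h
    rw [hπTn]; exact h
  -- the reduced action `g`
  set W := perWin 4 (N * L ^ (j + 1)) with hW
  set ι : ↥(skewSub 4 n N) × ↥KT →L[ℝ] ↥(skewSub 4 n N) × ↥Sl := (ContinuousLinearMap.id ℝ ↥(skewSub 4 n N)).prodMap iK with hι
  have hι0 : ι 0 = 0 := map_zero ι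
  set g : ↥(skewSub 4 n N) × ↥KT → ℝ := fun p =>
    fineAction (chart (ContinuousLinearMap.id ℝ (Matrix n n ℂ)) (L * tower L N j) Us ((θS (ι p) : ↥Sl) : TDir 4 n (L * tower L N j))) W with hg
  have hθι0 : θS (ι 0) = 0 := by rw [hι0, hθS0]
  have hθιc : ContDiffAt ℝ 2 (fun p : ↥(skewSub 4 n N) × ↥KT => θS (ι p)) 0 := by
    have h1 : ContDiffAt ℝ 2 θS (ι 0) := by rw [hι0]; exact hθSc
    exact h1.comp 0 ι.contDiff.contDiffAt
  have hcoec : ContDiffAt ℝ 2 (fun p : ↥(skewSub 4 n N) × ↥KT => ((θS (ι p) : ↥Sl) : TDir 4 n (L * tower L N j))) 0 :=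
    Sl.subtypeL.contDiff.contDiffAt.comp 0 hθιc
  have hgc : ContDiffAt ℝ 2 g 0 := by
    have hA : ContDiffAt ℝ 2 (fun Φ : TDir 4 n (L * tower L N j) => fineAction (chart (ContinuousLinearMap.id ℝ (Matrix n n ℂ)) (L * tower L N j) Us Φ) W)
        ((fun p : ↥(skewSub 4 n N) × ↥KT => ((θS (ι p) : ↥Sl) : TDir 4 n (L * tower L N j))) 0) := by
      simp only [hθι0, Submodule.coe_zero]
      exact contDiffAt_fineAction_chart (m := 2) (ContinuousLinearMap.id ℝ (Matrix n n ℂ)) (L * tower L N j) Us W 0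
    exact ContDiffAt.comp (f := fun p : ↥(skewSub 4 n N) × ↥KT => ((θS (ι p) : ↥Sl) : TDir 4 n (L * tower L N j))) 0 hA hcoec
  have hg0 : g 0 = fineAction Us W := by simp only [hg, hθι0, Submodule.coe_zero, chart_zero]
  -- the section `z ↦ g(0,z)`
  set inr : ↥KT →L[ℝ] ↥(skewSub 4 n N) × ↥KT := ContinuousLinearMap.inr ℝ ↥(skewSub 4 n N) ↥KT with hinr
  set g₀ : ↥KT → ℝ := fun z => g (inr z) with hg₀
  have hg₀c : ContDiffAt ℝ 2 g₀ 0 := by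
    have h1 : ContDiffAt ℝ 2 g (inr 0) := by rw [map_zero]; exact hgc
    exact h1.comp 0 inr.contDiff.contDiffAt
  have hg₀0 : g₀ 0 = fineAction Us W := by rw [hg₀]; show g (inr 0) = _; rw [map_zero, hg0]
  -- admissibility of `chart θ_Σ(0, z)` over `V₀` for small `z`
  have hV₀near : ∀ (r : Fin 4 → Fin N) (κ' : Fin 4),
      ‖(((V₀ (boxVec N r) κ')⁻¹ : (Matrix n n ℂ)ˣ) : Matrix n n ℂ) * (V₀ (boxVec N r) κ' : Matrix n n ℂ) - 1‖ ≤ 1 / 4 := fun r κ' => by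
    rw [Units.inv_mul, sub_self, norm_zero]; norm_num
  have htι : Tendsto (fun z : ↥KT => ι (inr z)) (𝓝 0) (𝓝 0) := by
    have h := (ι.comp inr).continuous.tendsto (0 : ↥KT); rwa [map_zero] at h
  have hadmz : ∀ᶠ z : ↥KT in 𝓝 0, chart (ContinuousLinearMap.id ℝ (Matrix n n ℂ)) (L * tower L N j) Us ((θS (ι (inr z)) : ↥Sl) : TDir 4 n (L * tower L N j))
      ∈ admissible (sfClass 4 L N ε) L (j + 1) V₀ := by
    filter_upwards [htι.eventually hfibS] with z hz
    exact hz.2.2 V₀ hV₀u hV₀P hV₀near (by rw [relLog_self, map_zero]; rfl)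
  -- `‖z‖ ≤ Kπ‖θ_Σ(0,z)‖` and `‖θ_Σ(0,z)‖ < ρ` for small `z`
  have htθ : Tendsto (fun z : ↥KT => θS (ι (inr z))) (𝓝 0) (𝓝 0) := by
    have h := hθιc.continuousAt; rw [ContinuousAt] at h; simp only [hθι0] at h
    exact h.comp (by have h2 := inr.continuous.tendsto (0 : ↥KT); rwa [map_zero] at h2)
  have htq : Tendsto (fun z : ↥KT => (((0 : ↥(skewSub 4 n N)), kz z) : ↥(skewSub 4 n N) × ↥(LinearMap.ker (G' : ↥Sl →ₗ[ℝ] ↥(skewSub 4 n N)))))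
      (𝓝 0) (𝓝 0) := by
    have h1 : Continuous (fun z : ↥KT => (((0 : ↥(skewSub 4 n N)), kz z) : ↥(skewSub 4 n N) × ↥(LinearMap.ker (G' : ↥Sl →ₗ[ℝ] ↥(skewSub 4 n N))))) :=
      continuous_const.prodMk hkzc
    have h2 := h1.tendsto 0
    rw [hkz0] at h2; exact h2
  have hzle : ∀ᶠ z : ↥KT in 𝓝 0, ‖z‖ ≤ Kπ * ‖θS (ι (inr z))‖ := by
    filter_upwards [htθ.eventually (Filter.eventually_of_mem htπ fun x hx => hx), htq.eventually hπfib] with z hzt hfz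
    have hιz : ι (inr z) = ((0 : ↥(skewSub 4 n N)), iK z) := rfl
    have hfz' : πS (θS (ι (inr z))) = iK z := by rw [hιz]; exact congrArg Subtype.val hfz
    have h := hπL.norm_sub_le hzt h0tπ
    rw [hπS0, sub_zero, sub_zero, hfz', hiKn] at h
    exact h
  have hsmall : ∀ᶠ z : ↥KT in 𝓝 0, ‖θS (ι (inr z))‖ < ρ := by
    have hb : ∀ᶠ s : ↥Sl in 𝓝 0, ‖s‖ < ρ := Filter.eventually_of_mem (Metric.ball_mem_nhds _ hρ) fun q hq => by rwa [mem_ball_zero_iff] at hq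
    exact htθ.eventually hb
  -- quadratic growth of `g₀` at `0`
  have hgrowth : ∀ᶠ z : ↥KT in 𝓝 0, c / ((Kπ : ℝ) ^ 2 + 1) * ‖z - 0‖ ^ 2 ≤ g₀ z - g₀ 0 := by
    filter_upwards [hadmz, hzle, hsmall] with z hadm hzK hzρ
    set sK : ↥(skewSub 4 n (L * tower L N j)) := ⟨((θS (ι (inr z)) : ↥Sl) : TDir 4 n (L * tower L N j)), hSlle (θS (ι (inr z))).2⟩ with hsK
    have hsKn : ‖sK‖ = ‖θS (ι (inr z))‖ := by rw [Submodule.coe_norm, Submodule.coe_norm (x := θS (ι (inr z)))]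
    have hq := hqg sK (θS (ι (inr z))).2 (by rw [hsKn]; exact hzρ) hadm
    have hg₀z : g₀ z = fineAction (chart (ContinuousLinearMap.id ℝ (Matrix n n ℂ)) (L * tower L N j) Us (sK : TDir 4 n (L * tower L N j))) W := rfl
    rw [sub_zero, hg₀z, hg₀0]
    have h1 : ‖z‖ ^ 2 ≤ ((Kπ : ℝ) * ‖sK‖) ^ 2 := by rw [hsKn]; exact pow_le_pow_left₀ (norm_nonneg _) hzK 2
    have h3 : c / ((Kπ : ℝ) ^ 2 + 1) * ‖z‖ ^ 2 ≤ c / ((Kπ : ℝ) ^ 2 + 1) * ((Kπ : ℝ) * ‖sK‖) ^ 2 := mul_le_mul_of_nonneg_left h1 (by positivity)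
    have h4 : c / ((Kπ : ℝ) ^ 2 + 1) * ((Kπ : ℝ) * ‖sK‖) ^ 2 = c * ‖sK‖ ^ 2 * ((Kπ : ℝ) ^ 2 / ((Kπ : ℝ) ^ 2 + 1)) := by ring
    have h5 : (Kπ : ℝ) ^ 2 / ((Kπ : ℝ) ^ 2 + 1) ≤ 1 := (div_le_one (by positivity)).mpr (by linarith)
    have h6 : c * ‖sK‖ ^ 2 * ((Kπ : ℝ) ^ 2 / ((Kπ : ℝ) ^ 2 + 1)) ≤ c * ‖sK‖ ^ 2 := mul_le_of_le_one_right (by positivity) h5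
    linarith
  -- minimality of `U♯` ⇒ local minimum ⇒ `∂_z g(0,0) = 0`
  set w : ℝ := ((stepWt 4 L)⁻¹) ^ (j + 1) with hw
  have hw0 : 0 < w := pow_pos (inv_pos.mpr (stepWt_pos (d := 4) L hL1)) _
  have hlev : ∀ Z : Site 4 → Fin 4 → (Matrix n n ℂ)ˣ, levelAction 4 L N (j + 1) Z = w * fineAction Z W := fun Z => by rw [hw, hW]; rfl
  have hmin : IsLocalMin g₀ 0 := by
    filter_upwards [hadmz] with z hadm
    have h := hUs.le _ hadm
    rw [hlev, hlev] at h
    have h2 := le_of_mul_le_mul_left h hw0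
    rw [hg₀0]; exact h2
  have hcrit : fderiv ℝ g₀ 0 = 0 := hmin.fderiv_eq_zero
  have hcoer : ∀ v : ↥KT, c / ((Kπ : ℝ) ^ 2 + 1) * ‖v‖ ^ 2 ≤ (fderiv ℝ (fderiv ℝ g₀) 0 v) v :=
    second_derivative_ge_of_quadratic_growth hg₀c (by positivity) hgrowth
  have hg₀eq : g₀ = fun z : ↥KT => g (0, z) := by funext z; rfl
  rw [hg₀eq] at hcrit hcoer
  obtain ⟨zs, hzsc, hzs0, hzscrit, hzsuniq⟩ :=
    implicit_critical_point (Y := ↥(skewSub 4 n N)) (Sg := ↥KT) hgc hcrit (by positivity : 0 < c / ((Kπ : ℝ) ^ 2 + 1)) hcoer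
  have hιp : ∀ p : ↥(skewSub 4 n N) × ↥KT, ι p = (p.1, iK p.2) := fun p => rfl
  refine ⟨Sl, ξ, σ, θS, KT, iK, πT, zs, hSlle, hξc, hσc, hξ0, hσ0, hprop, hright, hθSc, hθS0, hfibS, hiK, hπT0, hπTsec, ⟨Kπ, hπTK⟩, ?_, hzsc, hzs0, ?_, ?_⟩
  · simpa only [hg, hιp] using hgc
  · simpa only [hg, hιp] using hzscrit
  · simpa only [hg, hιp] using hzsuniq

end

end Summit.QuantumFields.BalabanUV.T4Continuum.NE7SliceCriticalBranchStabConst
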